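import Summits.BirchSwinnertonDyer.BirchSwinnertonDyer.Theorems.ManinLocalTwoThreeShimuraQuotientCuspidalInertia
import Summits.BirchSwinnertonDyer.Rank1Residual.ManinAdditive.KummerDiamondShapeLaws
import HarnessLib

/-!
# E-es-184 `DiamondCharacterConductorLaw` (LEMMA M) IS A THEOREM: the diamond character `ϖ : (ℤ/N)ˣ ↠ Λ₀(f)/Λ₁(f)` has conductor
# `M(N) = ∏_{p^v ∥ N} p^{⌈v/2⌉}` — `d_γ ≡ ±1 (mod M(N)) ⟹ {∞, γ∞}_f ∈ Λ₁(f)`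
(route `ManinLocalTwoThree`, crux C2 `ManinOddAtFour` stmt-BirchSwinnertonDyer-22967; cell bsd-f2-manin, prover p2 gen 21; es g38 MEMO-es §59.2, the support row
of the Kummer–diamond line; `--supports stmt-BirchSwinnertonDyer-22967`)

The tree's `…ShimuraQuotientCuspidalInertia` (LEAD p1 g15) proves, for EVERY factorisation `N = u²v`, that `d_γ ≡ ±1 (mod uv)` forces `{∞, γ∞}_f ∈ Λ₁(f)`
(the parabolic at the cusp `1/u`).  es g38's LEMMA M (row E-es-184 `KummerDiamond.DiamondCharacterConductorLaw`, `…/ManinAdditive/KummerDiamondShapeLaws.lean`)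
is the optimal instance `u = ∏ p^{⌊v_p/2⌋}`, `v = ∏ p^{v_p mod 2}`, for which `uv = ∏ p^{⌈v_p/2⌉} = ceilSqrtLevel N`.  This file supplies that
factorisation (`exists_sq_mul_eq_ceilSqrtLevel`, elementary bookkeeping on `Nat.factorization`) and the row BY NAME (`diamondCharacterConductorLaw_holds`).
UNCONDITIONAL; used by es's EXCLUSION THEOREM (§59.5 STEP 2).  Nothing about C2, Manin's conjecture or BSD is proved by this.  No definitions, no sorry.
[cite: Manin1972, Prop. 1.4 / Thm. 1.6 (parabolic elements have zero period)] [cite: LingOesterle1991, §1 and Thm. 1 (the conductor of the Shimura subgroup)]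
-/

set_option autoImplicit false
-- lint-debt: the directory name repeats the summit name (sibling precedent `ManinLocalTwoThreeShimuraQuotientCuspidalInertia.lean`)
set_option linter.dupNamespace false

noncomputable section

open scoped MatrixGroups
open CongruenceSubgroup Literature.NumberTheory.EllipticCurves Literature.NumberTheory.EllipticCurves.ModularForms
open Summit.BirchSwinnertonDyer.Rank1Residual.ManinAdditive.KummerDiamond

namespace Summit.BirchSwinnertonDyer.BirchSwinnertonDyer.Theorems.ManinLocalTwoThree.DiamondConductor

/-! ## §1 `N = u²v` with `uv = ceilSqrtLevel N` -/

/-- **The square-root factorisation of the level**: `N = u²·v` with `u = ∏ p^{⌊v_p/2⌋}`, `v = ∏ p^{v_p mod 2}`, and `u·v = ∏ p^{⌈v_p/2⌉} = ceilSqrtLevel N`.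
[folklore] -/
theorem exists_sq_mul_eq_ceilSqrtLevel {N : ℕ} (hN : N ≠ 0) :
    ∃ u v : ℕ, u ≠ 0 ∧ N = u ^ 2 * v ∧ u * v = ceilSqrtLevel N := by
  refine ⟨N.factorization.prod fun p k => p ^ (k / 2), N.factorization.prod fun p k => p ^ (k % 2), ?_, ?_, ?_⟩
  · rw [Finsupp.prod]
    exact Finset.prod_ne_zero_iff.mpr fun p hp =>
      pow_ne_zero _ (Nat.prime_of_mem_primeFactors (Nat.support_factorization N ▸ hp)).ne_zero
  · conv_lhs => rw [← Nat.prod_factorization_pow_eq_self hN]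
    rw [sq, ← Finsupp.prod_mul, ← Finsupp.prod_mul]
    refine Finsupp.prod_congr fun p _ ↦ ?_
    rw [← pow_add, ← pow_add]
    congr 1
    omega
  · rw [ceilSqrtLevel, ← Finsupp.prod_mul]
    refine Finsupp.prod_congr fun p _ ↦ ?_
    rw [← pow_add]
    congr 1
    omega

/-! ## §2 E-es-184 BY NAME -/

/-- **E-es-184 `DiamondCharacterConductorLaw` (LEMMA M) HOLDS**: for every `f ∈ S₂(Γ₀(N))` and `γ ∈ Γ₀(N)` with lower-right entry `≡ ±1 (mod ceilSqrtLevel N)`,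
`{∞, γ∞}_f ∈ Λ₁(f)` — the tree's cuspidal-inertia lemmas (`cuspSymbol_mem_periodLatticeGamma1_of_apply_eq_one_mod` / `…_neg_one_mod`, the parabolic at the
cusp `1/u`) at the square-root factorisation of §1.  UNCONDITIONAL. [cite: Manin1972, Prop. 1.4 / Thm. 1.6] [cite: LingOesterle1991, §1 and Thm. 1] -/
theorem diamondCharacterConductorLaw_holds : DiamondCharacterConductorLaw := by
  intro N _ f γ hd
  obtain ⟨u, v, hu, hNuv, huv⟩ := exists_sq_mul_eq_ceilSqrtLevel (NeZero.ne N)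
  have hN : (N : ℤ) = (u : ℤ) ^ 2 * v := by exact_mod_cast hNuv
  -- transport the congruence from `ZMod (ceilSqrtLevel N)` to `ZMod (u * v)`
  set d : ℤ := ((γ : SL(2, ℤ)) 1 1 : ℤ) with hddef
  rcases hd with h | h
  · have hdvd : ((ceilSqrtLevel N : ℕ) : ℤ) ∣ 1 - d := (ZMod.intCast_eq_intCast_iff_dvd_sub d 1 _).mp (by simpa using h)
    rw [← huv] at hdvd
    have h' : ((d : ℤ) : ZMod (u * v)) = 1 := by
      have := (ZMod.intCast_eq_intCast_iff_dvd_sub d 1 (u * v)).mpr hdvd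
      simpa using this
    exact cuspSymbol_mem_periodLatticeGamma1_of_apply_eq_one_mod f hu hN γ h'
  · have hdvd : ((ceilSqrtLevel N : ℕ) : ℤ) ∣ -1 - d := (ZMod.intCast_eq_intCast_iff_dvd_sub d (-1) _).mp (by simpa using h)
    rw [← huv] at hdvd
    have h' : ((d : ℤ) : ZMod (u * v)) = -1 := by
      have := (ZMod.intCast_eq_intCast_iff_dvd_sub d (-1) (u * v)).mpr hdvd
      simpa using this
    exact cuspSymbol_mem_periodLatticeGamma1_of_apply_eq_neg_one_mod f hu hN γ h'

end Summit.BirchSwinnertonDyer.BirchSwinnertonDyer.Theorems.ManinLocalTwoThree.DiamondConductor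

end
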